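import Literature.NumberTheory.Rogawski1990.SingularTransferMembers                  -- ★ #88 `SingularEllipticTransferCanonical` (the text pinned here) + ★ `SingularTransferMembers`, `…exists_singularTransferMembers`
import Literature.NumberTheory.Rogawski1990.ArchCanonicalTransferFactor              -- ★ `archCanonicalTransferFactor L H′ μω` = print's `Δ‴_∞` as an `ArchTransferFactor`
import Literature.NumberTheory.Rogawski1990.FinExplicitTransferFactorConjLeft          -- ★ `finExplicitDelta_conj_left_all` (the `hl` binder of ★ `finExplicitCollection`)
import Literature.NumberTheory.Rogawski1990.FinExplicitTransferFactorConjRight         -- ★ `finExplicitDelta_conj_right_all` (the `hr` binder)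
import HarnessLib

/-!
# [Rogawski1990 §14.5 L. 14.5.2 (b) pp. 238–239; §8.2 Prop. 8.2.1; §4.9 p. 55; Kottwitz1988 Thm. 1, Prop. 2] SINGULAR-ELLIPTIC TRANSFER (CANONICAL) **PINNED** —
# ★ #88 `SingularEllipticTransferCanonical` with the transfer-factor frame INSTANTIATED at print's pair `(Δ‴_∞, (Δ‴_v)_v)`

Topic `NumberTheory/Rogawski1990`; namespace `Literature.NumberTheory.Rogawski1990`.  STATEMENT FILE (definition lane): `def … : Prop` + specialisation ties and the
definitional-unfolding export (sorry-free); no instance, no notation.  Cell `pub/hodgecm-mathlib`, crux H413 = stmt-HodgeConjecture-24833, registry socket F0HJ3a =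
stmt-HodgeConjecture-27456.  ORDER «#175-R» (director g36 s1830; heir LEAD F0P3a-plan (g19) T18-10 «#175-R SCOPE» (1)(a) T2; desk F0P3-plan (g22) D-O7b (A); registrar
A-plan1 (g34) pen; design «HOIST, THEN PIN» of the siblings ★ `TamagawaSingularMembersFinTFCovolPinned` ∕ `TamagawaSingularMembersNormalisedLetterPinned`).  HONEST LABEL:
HC_CM is proved only modulo the printed citations until rung 0 closes; nothing here proves the fact — the pinned fact is a HYPOTHESIS wherever used.

WHY.  ★ `SingularEllipticTransferCanonical L H′ Tinf …` binds the finite collection `Δ : ∀ v, LocalTransferFactor L H′ v` universally (constrained only by `hCTM`, blind off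
G-regular classes) while its κ-conjuncts (κ-MASS) read singular classes — the weak frame on which the model-relative O7 witness against #175 lives (K2E4-r01 (g0)
9d20d85d782e07ce ∕ ad7420429788ac50).  The rung-0 witness field `Rung0WitnessS.hSET` (`Cruxes/H413/Lines/F0_U3LettersRung1Defs.lean` :1281 ff) and the closer ★
`F0P3Rung0OfLettersNormalised` :207 ∕ :346–349 read the fact ONLY at `Tinf := archCanonicalTransferFactor L H μω`; T4 re-types that field to the PINNED fact below and T1 ∕ T3
(F0P3a-p01 (g30)) prove it from the pinned letters.

WHAT (every statement token of ★ `SingularEllipticTransferCanonical` byte-identical — this file RE-BINDS, it does not re-word):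
* `SingularEllipticTransferCanonicalAtDelta L H′ Tinf Δ νH νG νGi νqi νHi νA` — the fact AT A FRAME with `Δ` HOISTED to a parameter: ★'s body VERBATIM minus its one binder line
  `(Δ : ∀ v, LocalTransferFactor L H′ v)` (`hanis Sbad mH mG`, the `CanonicalTransferMatrix` antecedent, `m′ m mHi t′ t tH hACS` stay binders; conclusion untouched).
* `SingularEllipticTransferCanonicalPinned L H′ μω νH νG νGi νqi νHi νA := …AtDelta L H′ (archCanonicalTransferFactor L H′ μω) (finExplicitCollection L H′ μω …) …` — PINNED;
  THE TYPE of `Rung0WitnessS.hSET` from Defs ED. «#175 PINNED» on (applied `… L H μω νH νG νGi νqi νHi ν`).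
* ties `singularEllipticTransferCanonicalAtDelta_of`, `singularEllipticTransferCanonicalPinned_of` (∀Δ ⇒ at `Δ` ∕ pinned — instantiation only), and the export
  `SingularEllipticTransferCanonicalAtDelta.exists_singularTransferMembers` (★ `SingularEllipticTransferCanonical.exists_singularTransferMembers` at a fixed `Δ`, for MAIN-b-style callers).

## References

* [Rogawski1990] J. D. Rogawski, *Automorphic Representations of Unitary Groups in Three Variables*, Ann. of Math. Stud. 123 (1990): §14.5 Lemma 14.5.2 (b)
  pp. 238–239; §8.2 Prop. 8.2.1 (a), (b), (d) pp. 117–118; §8.1 Prop. 8.1.3, 8.1.4 p. 117; §8.3 Prop. 8.3.1; §4.9 p. 55; §14.6 p. 242; §1.7 p. 6.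
* [Kottwitz1988] R. E. Kottwitz, *Tamagawa numbers*, Ann. of Math. (2) 127 (1988): Thm. 1, Prop. 2.
* [Kottwitz1986] R. E. Kottwitz, *Stable trace formula: elliptic singular terms*, Math. Ann. 275 (1986): §9.
* [LanglandsShelstad1987] R. P. Langlands, D. Shelstad, *On the definition of transfer factors*, Math. Ann. 278 (1987): §1.3–§1.4, §3–§4.
-/

set_option autoImplicit false

noncomputable section

open MeasureTheory Measure NumberField IsDedekindDomain
open Literature.MeasureTheory.Group
open scoped Matrix MatrixGroups

namespace Literature.NumberTheory.Rogawski1990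

open Literature.NumberTheory.Automorphic
open Literature.AlgebraicGeometry.ShimuraVarieties (unitaryGroup hermForm)
open Literature.NumberTheory.GaloisRepresentations (HeckeCharacter)

section FactPinned

variable (L : Type) [Field L] [NumberField L] [IsCMField L] (H' : Matrix (Fin 3) (Fin 3) L) (Tinf : ArchTransferFactor L H')
    (Δ : ∀ v : HeightOneSpectrum (𝓞 ↥(maximalRealSubfield L)), LocalTransferFactor L H' v) (μω : HeckeCharacter L)
    -- σ-algebras of the `G′` side (★ (O10-c5) block), of `H_v`, `G_∞`, `H_∞`, and the Haar data — EXACTLY ★ `SingularEllipticTransfer`'s binders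
    [∀ g : (UnitaryGroup.cmDatum L 3 H').Adelic, MeasurableSpace ((UnitaryGroup.cmDatum L 3 H').Adelic ⧸ Subgroup.centralizer ({g} : Set (UnitaryGroup.cmDatum L 3 H').Adelic))]
    [∀ g : (UnitaryGroup.cmDatum L 3 H').Adelic, BorelSpace ((UnitaryGroup.cmDatum L 3 H').Adelic ⧸ Subgroup.centralizer ({g} : Set (UnitaryGroup.cmDatum L 3 H').Adelic))]
    [∀ γ : UnitaryGroup.arch (↥(maximalRealSubfield L)) L (IsCMField.complexConj L) 3 H',
      MeasurableSpace (UnitaryGroup.arch (↥(maximalRealSubfield L)) L (IsCMField.complexConj L) 3 H' ⧸ Subgroup.centralizer ({γ} : Set (UnitaryGroup.arch (↥(maximalRealSubfield L)) L (IsCMField.complexConj L) 3 H')))]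
    [∀ γ : UnitaryGroup.arch (↥(maximalRealSubfield L)) L (IsCMField.complexConj L) 3 H',
      BorelSpace (UnitaryGroup.arch (↥(maximalRealSubfield L)) L (IsCMField.complexConj L) 3 H' ⧸ Subgroup.centralizer ({γ} : Set (UnitaryGroup.arch (↥(maximalRealSubfield L)) L (IsCMField.complexConj L) 3 H')))]
    [∀ (v : HeightOneSpectrum (𝓞 ↥(maximalRealSubfield L))) (γ : (UnitaryGroup.cmDatum L 3 H').Local v),
      MeasurableSpace ((UnitaryGroup.cmDatum L 3 H').Local v ⧸ Subgroup.centralizer ({γ} : Set ((UnitaryGroup.cmDatum L 3 H').Local v)))]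
    [∀ (v : HeightOneSpectrum (𝓞 ↥(maximalRealSubfield L))) (γ : (UnitaryGroup.cmDatum L 3 H').Local v),
      BorelSpace ((UnitaryGroup.cmDatum L 3 H').Local v ⧸ Subgroup.centralizer ({γ} : Set ((UnitaryGroup.cmDatum L 3 H').Local v)))]
    [∀ v : HeightOneSpectrum (𝓞 ↥(maximalRealSubfield L)), MeasurableSpace ((UnitaryGroup.cmDatum L 3 H').Local v)] [∀ v : HeightOneSpectrum (𝓞 ↥(maximalRealSubfield L)), BorelSpace ((UnitaryGroup.cmDatum L 3 H').Local v)]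
    [MeasurableSpace (UnitaryGroup.cmDatum L 3 H').Adelic] [BorelSpace (UnitaryGroup.cmDatum L 3 H').Adelic]
    [MeasurableSpace (UnitaryGroup.arch (↥(maximalRealSubfield L)) L (IsCMField.complexConj L) 3 H')] [BorelSpace (UnitaryGroup.arch (↥(maximalRealSubfield L)) L (IsCMField.complexConj L) 3 H')]
    [∀ γ : (UnitaryGroup.cmDatum L 3 H').Adelic, MeasurableSpace (↥(Subgroup.centralizer ({γ} : Set (UnitaryGroup.cmDatum L 3 H').Adelic)) ⧸
      ((UnitaryGroup.cmDatum L 3 H').quotientSubgroup ⊓ Subgroup.centralizer ({γ} : Set (UnitaryGroup.cmDatum L 3 H').Adelic)).subgroupOf (Subgroup.centralizer ({γ} : Set (UnitaryGroup.cmDatum L 3 H').Adelic)))]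
    [∀ γ : (UnitaryGroup.cmDatum L 3 H').Adelic, BorelSpace (↥(Subgroup.centralizer ({γ} : Set (UnitaryGroup.cmDatum L 3 H').Adelic)) ⧸
      ((UnitaryGroup.cmDatum L 3 H').quotientSubgroup ⊓ Subgroup.centralizer ({γ} : Set (UnitaryGroup.cmDatum L 3 H').Adelic)).subgroupOf (Subgroup.centralizer ({γ} : Set (UnitaryGroup.cmDatum L 3 H').Adelic)))]
    [hCcl : ∀ γ : (UnitaryGroup.cmDatum L 3 H').Adelic, IsClosed ((Subgroup.centralizer ({γ} : Set (UnitaryGroup.cmDatum L 3 H').Adelic) : Subgroup (UnitaryGroup.cmDatum L 3 H').Adelic) : Set (UnitaryGroup.cmDatum L 3 H').Adelic)]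
    [∀ γ : (UnitaryGroup.cmDatum L 3 H').Adelic, (count : Measure ↥(((UnitaryGroup.cmDatum L 3 H').quotientSubgroup ⊓ Subgroup.centralizer ({γ} : Set (UnitaryGroup.cmDatum L 3 H').Adelic)).subgroupOf
      (Subgroup.centralizer ({γ} : Set (UnitaryGroup.cmDatum L 3 H').Adelic)))).IsHaarMeasure]
    [∀ v : HeightOneSpectrum (𝓞 ↥(maximalRealSubfield L)), MeasurableSpace ((UnitaryGroup.cmDatum L 2 (Matrix.of fun i j : Fin 2 => if i.val + j.val + 1 = 2 then (1 : L) else 0)).Local v ×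
        (UnitaryGroup.cmDatum L 1 (Matrix.of fun i j : Fin 1 => if i.val + j.val + 1 = 1 then (1 : L) else 0)).Local v)]
    [∀ v : HeightOneSpectrum (𝓞 ↥(maximalRealSubfield L)), BorelSpace ((UnitaryGroup.cmDatum L 2 (Matrix.of fun i j : Fin 2 => if i.val + j.val + 1 = 2 then (1 : L) else 0)).Local v ×
        (UnitaryGroup.cmDatum L 1 (Matrix.of fun i j : Fin 1 => if i.val + j.val + 1 = 1 then (1 : L) else 0)).Local v)]
    [∀ (v : HeightOneSpectrum (𝓞 ↥(maximalRealSubfield L))) (a : ((UnitaryGroup.cmDatum L 2 (Matrix.of fun i j : Fin 2 => if i.val + j.val + 1 = 2 then (1 : L) else 0)).Local v ×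
        (UnitaryGroup.cmDatum L 1 (Matrix.of fun i j : Fin 1 => if i.val + j.val + 1 = 1 then (1 : L) else 0)).Local v)),
      MeasurableSpace (((UnitaryGroup.cmDatum L 2 (Matrix.of fun i j : Fin 2 => if i.val + j.val + 1 = 2 then (1 : L) else 0)).Local v ×
        (UnitaryGroup.cmDatum L 1 (Matrix.of fun i j : Fin 1 => if i.val + j.val + 1 = 1 then (1 : L) else 0)).Local v) ⧸ Subgroup.centralizer ({a} : Set ((UnitaryGroup.cmDatum L 2 (Matrix.of fun i j : Fin 2 => if i.val + j.val + 1 = 2 then (1 : L) else 0)).Local v ×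
        (UnitaryGroup.cmDatum L 1 (Matrix.of fun i j : Fin 1 => if i.val + j.val + 1 = 1 then (1 : L) else 0)).Local v)))]
    [∀ (v : HeightOneSpectrum (𝓞 ↥(maximalRealSubfield L))) (a : ((UnitaryGroup.cmDatum L 2 (Matrix.of fun i j : Fin 2 => if i.val + j.val + 1 = 2 then (1 : L) else 0)).Local v ×
        (UnitaryGroup.cmDatum L 1 (Matrix.of fun i j : Fin 1 => if i.val + j.val + 1 = 1 then (1 : L) else 0)).Local v)),
      BorelSpace (((UnitaryGroup.cmDatum L 2 (Matrix.of fun i j : Fin 2 => if i.val + j.val + 1 = 2 then (1 : L) else 0)).Local v ×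
        (UnitaryGroup.cmDatum L 1 (Matrix.of fun i j : Fin 1 => if i.val + j.val + 1 = 1 then (1 : L) else 0)).Local v) ⧸ Subgroup.centralizer ({a} : Set ((UnitaryGroup.cmDatum L 2 (Matrix.of fun i j : Fin 2 => if i.val + j.val + 1 = 2 then (1 : L) else 0)).Local v ×
        (UnitaryGroup.cmDatum L 1 (Matrix.of fun i j : Fin 1 => if i.val + j.val + 1 = 1 then (1 : L) else 0)).Local v)))]
    [MeasurableSpace (UnitaryGroup.arch (↥(maximalRealSubfield L)) L (IsCMField.complexConj L) 3 (Matrix.of fun i j : Fin 3 => if i.val + j.val + 1 = 3 then (1 : L) else 0))] [BorelSpace (UnitaryGroup.arch (↥(maximalRealSubfield L)) L (IsCMField.complexConj L) 3 (Matrix.of fun i j : Fin 3 => if i.val + j.val + 1 = 3 then (1 : L) else 0))]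
    [∀ γ : UnitaryGroup.arch (↥(maximalRealSubfield L)) L (IsCMField.complexConj L) 3 (Matrix.of fun i j : Fin 3 => if i.val + j.val + 1 = 3 then (1 : L) else 0),
      MeasurableSpace (UnitaryGroup.arch (↥(maximalRealSubfield L)) L (IsCMField.complexConj L) 3 (Matrix.of fun i j : Fin 3 => if i.val + j.val + 1 = 3 then (1 : L) else 0) ⧸ Subgroup.centralizer ({γ} : Set (UnitaryGroup.arch (↥(maximalRealSubfield L)) L (IsCMField.complexConj L) 3 (Matrix.of fun i j : Fin 3 => if i.val + j.val + 1 = 3 then (1 : L) else 0))))]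
    [∀ γ : UnitaryGroup.arch (↥(maximalRealSubfield L)) L (IsCMField.complexConj L) 3 (Matrix.of fun i j : Fin 3 => if i.val + j.val + 1 = 3 then (1 : L) else 0),
      BorelSpace (UnitaryGroup.arch (↥(maximalRealSubfield L)) L (IsCMField.complexConj L) 3 (Matrix.of fun i j : Fin 3 => if i.val + j.val + 1 = 3 then (1 : L) else 0) ⧸ Subgroup.centralizer ({γ} : Set (UnitaryGroup.arch (↥(maximalRealSubfield L)) L (IsCMField.complexConj L) 3 (Matrix.of fun i j : Fin 3 => if i.val + j.val + 1 = 3 then (1 : L) else 0))))]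
    [MeasurableSpace (UnitaryGroup.arch (↥(maximalRealSubfield L)) L (IsCMField.complexConj L) 2 (Matrix.of fun i j : Fin 2 => if i.val + j.val + 1 = 2 then (1 : L) else 0) ×
          UnitaryGroup.arch (↥(maximalRealSubfield L)) L (IsCMField.complexConj L) 1 (Matrix.of fun i j : Fin 1 => if i.val + j.val + 1 = 1 then (1 : L) else 0))]
    [BorelSpace (UnitaryGroup.arch (↥(maximalRealSubfield L)) L (IsCMField.complexConj L) 2 (Matrix.of fun i j : Fin 2 => if i.val + j.val + 1 = 2 then (1 : L) else 0) ×
          UnitaryGroup.arch (↥(maximalRealSubfield L)) L (IsCMField.complexConj L) 1 (Matrix.of fun i j : Fin 1 => if i.val + j.val + 1 = 1 then (1 : L) else 0))]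
    [∀ a : (UnitaryGroup.arch (↥(maximalRealSubfield L)) L (IsCMField.complexConj L) 2 (Matrix.of fun i j : Fin 2 => if i.val + j.val + 1 = 2 then (1 : L) else 0) ×
          UnitaryGroup.arch (↥(maximalRealSubfield L)) L (IsCMField.complexConj L) 1 (Matrix.of fun i j : Fin 1 => if i.val + j.val + 1 = 1 then (1 : L) else 0)),
      MeasurableSpace ((UnitaryGroup.arch (↥(maximalRealSubfield L)) L (IsCMField.complexConj L) 2 (Matrix.of fun i j : Fin 2 => if i.val + j.val + 1 = 2 then (1 : L) else 0) ×
          UnitaryGroup.arch (↥(maximalRealSubfield L)) L (IsCMField.complexConj L) 1 (Matrix.of fun i j : Fin 1 => if i.val + j.val + 1 = 1 then (1 : L) else 0)) ⧸ Subgroup.centralizer ({a} : Set (UnitaryGroup.arch (↥(maximalRealSubfield L)) L (IsCMField.complexConj L) 2 (Matrix.of fun i j : Fin 2 => if i.val + j.val + 1 = 2 then (1 : L) else 0) ×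
          UnitaryGroup.arch (↥(maximalRealSubfield L)) L (IsCMField.complexConj L) 1 (Matrix.of fun i j : Fin 1 => if i.val + j.val + 1 = 1 then (1 : L) else 0))))]
    [∀ a : (UnitaryGroup.arch (↥(maximalRealSubfield L)) L (IsCMField.complexConj L) 2 (Matrix.of fun i j : Fin 2 => if i.val + j.val + 1 = 2 then (1 : L) else 0) ×
          UnitaryGroup.arch (↥(maximalRealSubfield L)) L (IsCMField.complexConj L) 1 (Matrix.of fun i j : Fin 1 => if i.val + j.val + 1 = 1 then (1 : L) else 0)),
      BorelSpace ((UnitaryGroup.arch (↥(maximalRealSubfield L)) L (IsCMField.complexConj L) 2 (Matrix.of fun i j : Fin 2 => if i.val + j.val + 1 = 2 then (1 : L) else 0) ×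
          UnitaryGroup.arch (↥(maximalRealSubfield L)) L (IsCMField.complexConj L) 1 (Matrix.of fun i j : Fin 1 => if i.val + j.val + 1 = 1 then (1 : L) else 0)) ⧸ Subgroup.centralizer ({a} : Set (UnitaryGroup.arch (↥(maximalRealSubfield L)) L (IsCMField.complexConj L) 2 (Matrix.of fun i j : Fin 2 => if i.val + j.val + 1 = 2 then (1 : L) else 0) ×
          UnitaryGroup.arch (↥(maximalRealSubfield L)) L (IsCMField.complexConj L) 1 (Matrix.of fun i j : Fin 1 => if i.val + j.val + 1 = 1 then (1 : L) else 0))))]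
    (νH : ∀ v : HeightOneSpectrum (𝓞 ↥(maximalRealSubfield L)), Measure ((UnitaryGroup.cmDatum L 2 (Matrix.of fun i j : Fin 2 => if i.val + j.val + 1 = 2 then (1 : L) else 0)).Local v ×
        (UnitaryGroup.cmDatum L 1 (Matrix.of fun i j : Fin 1 => if i.val + j.val + 1 = 1 then (1 : L) else 0)).Local v))
    (νG : ∀ v : HeightOneSpectrum (𝓞 ↥(maximalRealSubfield L)), Measure ((UnitaryGroup.cmDatum L 3 H').Local v))
    [∀ v, IsFiniteMeasureOnCompacts (νH v)] [∀ v, (νH v).IsMulRightInvariant]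
    [∀ v, IsFiniteMeasureOnCompacts (νG v)] [∀ v, (νG v).IsMulRightInvariant]
    (νGi : Measure (UnitaryGroup.arch (↥(maximalRealSubfield L)) L (IsCMField.complexConj L) 3 H')) (νqi : Measure (UnitaryGroup.arch (↥(maximalRealSubfield L)) L (IsCMField.complexConj L) 3 (Matrix.of fun i j : Fin 3 => if i.val + j.val + 1 = 3 then (1 : L) else 0)))
    (νHi : Measure (UnitaryGroup.arch (↥(maximalRealSubfield L)) L (IsCMField.complexConj L) 2 (Matrix.of fun i j : Fin 2 => if i.val + j.val + 1 = 2 then (1 : L) else 0) ×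
          UnitaryGroup.arch (↥(maximalRealSubfield L)) L (IsCMField.complexConj L) 1 (Matrix.of fun i j : Fin 1 => if i.val + j.val + 1 = 1 then (1 : L) else 0)))
    [IsFiniteMeasureOnCompacts νGi] [νGi.IsMulRightInvariant] [IsFiniteMeasureOnCompacts νqi] [νqi.IsMulRightInvariant]
    [IsFiniteMeasureOnCompacts νHi] [νHi.IsMulRightInvariant]
    (νA : Measure (UnitaryGroup.cmDatum L 3 H').Adelic) [νA.IsHaarMeasure] [νA.IsMulRightInvariant]

/-! ## §1 THE FACT AT A FRAME, AT A FIXED FINITE COLLECTION `Δ` (the `Δ`-binder hoisted; every other token of ★ `SingularEllipticTransferCanonical` verbatim) -/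

set_option maxHeartbeats 16000000 in
set_option synthInstance.maxHeartbeats 800000 in
/-- **[Rogawski1990 §14.5 L. 14.5.2 (b); §8.2 Prop. 8.2.1; Kottwitz1988 Prop. 2] SINGULAR-ELLIPTIC TRANSFER (CANONICAL) AT A FRAME, AT THE COLLECTION `Δ`** — the body of
★ `SingularEllipticTransferCanonical L H′ Tinf νH νG νGi νqi νHi νA` with its binder `(Δ : ∀ v, LocalTransferFactor L H′ v)` removed (`Δ` is this def's parameter): for all
`hanis Sbad mH mG`, `CanonicalTransferMatrix L H′ Tinf.Δ νH νG Sbad Δ mH mG →` for all `m′ m mHi t′ t tH (hACS : ArchCanonicalSingularMatrix …)`, ★'s conclusion VERBATIM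
(singular members with (Q) (C1) (NORM) (K7-s) (ST-s), (κ-MASS), the transfer identity).  A HYPOTHESIS wherever used; see ★'s docstring for the clause-by-clause reading.
[cite: Rogawski1990, §14.5 Lemma 14.5.2 (b) pp. 238–239; §8.2 Prop. 8.2.1 (a), (b), (d) pp. 117–118; §8.3 Prop. 8.3.1; §1.7 p. 6] [cite: Kottwitz1988, Thm. 1, Prop. 2] [cite: Kottwitz1986, §9] [cite: LanglandsShelstad1987, §1.3–1.4; §3–§4] -/
def SingularEllipticTransferCanonicalAtDelta : Prop :=
  ∀ (hanis : ∀ x : Fin 3 → L, hermForm (cmConjRingHom L) H' x x = 0 → x = 0),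
  -- the data `(Sbad, Δ, mH, mG)` and the ED. 3 MATRIX `CanonicalTransferMatrix` (the first three conjuncts of EVERY edition of the global fact)
  ∀ (Sbad : Finset (HeightOneSpectrum (𝓞 ↥(maximalRealSubfield L))))
      (mH : ∀ v : HeightOneSpectrum (𝓞 ↥(maximalRealSubfield L)),
        OrbitalMeasureFamily ((UnitaryGroup.cmDatum L 2 (Matrix.of fun i j : Fin 2 => if i.val + j.val + 1 = 2 then (1 : L) else 0)).Local v ×
          (UnitaryGroup.cmDatum L 1 (Matrix.of fun i j : Fin 1 => if i.val + j.val + 1 = 1 then (1 : L) else 0)).Local v))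
      (mG : ∀ v : HeightOneSpectrum (𝓞 ↥(maximalRealSubfield L)), OrbitalMeasureFamily ((UnitaryGroup.cmDatum L 3 H').Local v)),
    CanonicalTransferMatrix L H' Tinf.Δ νH νG Sbad Δ mH mG →
  -- the data and MATRIX of ★ `ArchTransfersExistCanonicalSingular L H′ Tinf νGi νqi νHi`
  ∀ (m' : OrbitalMeasureFamily (UnitaryGroup.arch (↥(maximalRealSubfield L)) L (IsCMField.complexConj L) 3 H'))
        (m : OrbitalMeasureFamily (UnitaryGroup.arch (↥(maximalRealSubfield L)) L (IsCMField.complexConj L) 3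
          (Matrix.of fun i j : Fin 3 => if i.val + j.val + 1 = 3 then (1 : L) else 0)))
        (mHi : OrbitalMeasureFamily (UnitaryGroup.arch (↥(maximalRealSubfield L)) L (IsCMField.complexConj L) 2
            (Matrix.of fun i j : Fin 2 => if i.val + j.val + 1 = 2 then (1 : L) else 0) ×
          UnitaryGroup.arch (↥(maximalRealSubfield L)) L (IsCMField.complexConj L) 1
            (Matrix.of fun i j : Fin 1 => if i.val + j.val + 1 = 1 then (1 : L) else 0)))
        (t' : ∀ γ' : UnitaryGroup.arch (↥(maximalRealSubfield L)) L (IsCMField.complexConj L) 3 H',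
          Measure (Subgroup.centralizer ({γ'} : Set (UnitaryGroup.arch (↥(maximalRealSubfield L)) L (IsCMField.complexConj L) 3 H'))))
        (t : ∀ γ : UnitaryGroup.arch (↥(maximalRealSubfield L)) L (IsCMField.complexConj L) 3
            (Matrix.of fun i j : Fin 3 => if i.val + j.val + 1 = 3 then (1 : L) else 0),
          Measure (Subgroup.centralizer ({γ} : Set (UnitaryGroup.arch (↥(maximalRealSubfield L)) L (IsCMField.complexConj L) 3
            (Matrix.of fun i j : Fin 3 => if i.val + j.val + 1 = 3 then (1 : L) else 0)))))
        (tH : ∀ γH : UnitaryGroup.arch (↥(maximalRealSubfield L)) L (IsCMField.complexConj L) 2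
              (Matrix.of fun i j : Fin 2 => if i.val + j.val + 1 = 2 then (1 : L) else 0) ×
            UnitaryGroup.arch (↥(maximalRealSubfield L)) L (IsCMField.complexConj L) 1
              (Matrix.of fun i j : Fin 1 => if i.val + j.val + 1 = 1 then (1 : L) else 0),
          Measure (Subgroup.centralizer ({γH} : Set (UnitaryGroup.arch (↥(maximalRealSubfield L)) L (IsCMField.complexConj L) 2
              (Matrix.of fun i j : Fin 2 => if i.val + j.val + 1 = 2 then (1 : L) else 0) ×
            UnitaryGroup.arch (↥(maximalRealSubfield L)) L (IsCMField.complexConj L) 1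
              (Matrix.of fun i j : Fin 1 => if i.val + j.val + 1 = 1 then (1 : L) else 0))))),
    ArchCanonicalSingularMatrix L H' Tinf νGi νqi νHi hanis m' m mHi t' t tH →
  -- THE SINGULAR MEMBERS — Tamagawa-compatible local ∕ archimedean orbital measure families at the NON-REGULAR semisimple classes, EXISTENTIALLY
  ∃ (mGs : ∀ v : HeightOneSpectrum (𝓞 ↥(maximalRealSubfield L)), OrbitalMeasureFamily ((UnitaryGroup.cmDatum L 3 H').Local v))
    (mGis : OrbitalMeasureFamily (UnitaryGroup.arch (↥(maximalRealSubfield L)) L (IsCMField.complexConj L) 3 H'))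
    (mqis : OrbitalMeasureFamily (UnitaryGroup.arch (↥(maximalRealSubfield L)) L (IsCMField.complexConj L) 3 (Matrix.of fun i j : Fin 3 => if i.val + j.val + 1 = 3 then (1 : L) else 0))),
    -- (ADM) admissibility on the local ∕ archimedean stable classes of every non-regular rational `γ₀` (the closer's `hadmG′`, `hadmAG′`, `hadmAG`)
    (∀ γ₀ : (UnitaryGroup.cmDatum L 3 H').Rational, ¬ IsRegularElt (γ₀.val : GL (Fin 3) L) →
      (∀ v, (mGs v).IsAdmissibleOn fun x : (UnitaryGroup.cmDatum L 3 H').Local v =>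
        Corresponds (UnitaryGroup.conjLocal L (IsCMField.complexConj L) v)
          ((UnitaryGroup.adelicForm L 3 H').map (UnitaryGroup.adeleToLocal L v))
          ((UnitaryGroup.adelicForm L 3 H').map (UnitaryGroup.adeleToLocal L v))
          ((UnitaryGroup.cmDatum L 3 H').toLocal v ((UnitaryGroup.cmDatum L 3 H').toAdelic γ₀)) x) ∧
      mGis.IsAdmissibleOn (fun x : UnitaryGroup.arch (↥(maximalRealSubfield L)) L (IsCMField.complexConj L) 3 H' =>
        Corresponds (UnitaryGroup.conjMixed (↥(maximalRealSubfield L)) L (IsCMField.complexConj L)) (UnitaryGroup.archFormOf L 3 H')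
          (UnitaryGroup.archFormOf L 3 H') (cmRationalToArch L 3 H' γ₀) x) ∧
      mqis.IsAdmissibleOn (fun x : UnitaryGroup.arch (↥(maximalRealSubfield L)) L (IsCMField.complexConj L) 3 (Matrix.of fun i j : Fin 3 => if i.val + j.val + 1 = 3 then (1 : L) else 0) =>
        Corresponds (UnitaryGroup.conjMixed (↥(maximalRealSubfield L)) L (IsCMField.complexConj L)) (UnitaryGroup.archFormOf L 3 H')
          (UnitaryGroup.archFormOf L 3 (Matrix.of fun i j : Fin 3 => if i.val + j.val + 1 = 3 then (1 : L) else 0)) (cmRationalToArch L 3 H' γ₀) x)) ∧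
    -- (NORM) normalisation of the local members off a finite set at every non-regular rational point (the closer's `hpin`, ★ (A-s)'s `hnorm`)
    (∀ γ₀ : (UnitaryGroup.cmDatum L 3 H').Rational, ¬ IsRegularElt (γ₀.val : GL (Fin 3) L) →
      ∃ S₀ : Finset (HeightOneSpectrum (𝓞 ↥(maximalRealSubfield L))), UnitaryGroup.IsNormalisedOff L 3 H' mGs ((UnitaryGroup.cmDatum L 3 H').toAdelic γ₀) S₀) ∧
    -- (CEN) total adelic mass one at the central classes [Prop. 10.1.2 (b)(2): `Φ(ζ•1, f) = f(ζ•1)`] (anchor of `PinMuAMassCentral`)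
    (∀ c : ConjClasses (UnitaryGroup.cmDatum L 3 H').Rational,
      (∃ ζ : L, (((Quotient.out c).val : GL (Fin 3) L) : Matrix (Fin 3) (Fin 3) L) = ζ • (1 : Matrix (Fin 3) (Fin 3) L)) →
      UnitaryGroup.AdelicOrbitalMeasureFamily.ofLocal L 3 H' mGs mGis c Set.univ = 1) ∧
    -- (K7-s) [Kottwitz1988 Thm. 1; Rogawski1990 §1.7, §4.3] the covolume weights of `ofLocal mGs mGis` are CONSTANT on each non-regular stable class —
    -- the `hstab_s` letter of ★ (A-s) `exists_absorbedFamily_ofLocal_stableCovolWeight`, its Haar-reading hypothesis restricted to the non-regular classes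
    (∀ (νZ : ∀ c : ConjClasses (UnitaryGroup.cmDatum L 3 H').Rational,
        Measure ↥(Subgroup.centralizer ({(UnitaryGroup.cmDatum L 3 H').toAdelic (Quotient.out c)} : Set (UnitaryGroup.cmDatum L 3 H').Adelic)))
      (_ : ∀ c, IsHaarMeasure (νZ c)) (_ : ∀ c, (νZ c).IsMulRightInvariant) (_ : ∀ c, (νZ c).IsInvInvariant),
      (∀ c, ¬ IsRegularElt ((Quotient.out c).val : GL (Fin 3) L) →
        UnitaryGroup.AdelicOrbitalMeasureFamily.ofLocal L 3 H' mGs mGis c =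
          quotientMeasure (Subgroup.centralizer ({(UnitaryGroup.cmDatum L 3 H').toAdelic (Quotient.out c)} : Set (UnitaryGroup.cmDatum L 3 H').Adelic)) (νZ c) (hCcl _) νA) →
      ∀ c c' : ConjClasses (UnitaryGroup.cmDatum L 3 H').Rational, ¬ IsRegularElt ((Quotient.out c).val : GL (Fin 3) L) →
        StableClass.ofConjClass c = StableClass.ofConjClass c' →
        quotientMeasure (((UnitaryGroup.cmDatum L 3 H').quotientSubgroup ⊓
              Subgroup.centralizer ({(UnitaryGroup.cmDatum L 3 H').toAdelic (Quotient.out c)} : Set (UnitaryGroup.cmDatum L 3 H').Adelic)).subgroupOf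
              (Subgroup.centralizer ({(UnitaryGroup.cmDatum L 3 H').toAdelic (Quotient.out c)} : Set (UnitaryGroup.cmDatum L 3 H').Adelic))) count
              (isClosed_subgroupOf _ _ ((UnitaryGroup.isClosed_cmDatum_quotientSubgroup L 3 H').inter (hCcl _))) (νZ c) Set.univ =
          quotientMeasure (((UnitaryGroup.cmDatum L 3 H').quotientSubgroup ⊓
              Subgroup.centralizer ({(UnitaryGroup.cmDatum L 3 H').toAdelic (Quotient.out c')} : Set (UnitaryGroup.cmDatum L 3 H').Adelic)).subgroupOf
              (Subgroup.centralizer ({(UnitaryGroup.cmDatum L 3 H').toAdelic (Quotient.out c')} : Set (UnitaryGroup.cmDatum L 3 H').Adelic))) count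
              (isClosed_subgroupOf _ _ ((UnitaryGroup.isClosed_cmDatum_quotientSubgroup L 3 H').inter (hCcl _))) (νZ c') Set.univ) ∧
    -- (ST-∞) [Lemma 14.5.2 (b) st-half at `∞`; Kottwitz1988 Prop. 2; (4.1.2)] the SIGNED singular archimedean stable orbital integrals (Kottwitz's signs `e_∞` as
    -- class-constant weights on the functions, ★-to-be `kottwitzSignArchWeight`) of every smooth (14.2.1)-pair AGREE for `(mGis, mqis)` — the pair relation read
    -- at the REGULAR archimedean families `m′`, `m`; the `harchW` hypothesis of ★-to-be (SA-st-w) at `E = e`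
    (∀ (a' : UnitaryGroup.arch (↥(maximalRealSubfield L)) L (IsCMField.complexConj L) 3 H' → ℂ)
      (a : UnitaryGroup.arch (↥(maximalRealSubfield L)) L (IsCMField.complexConj L) 3 (Matrix.of fun i j : Fin 3 => if i.val + j.val + 1 = 3 then (1 : L) else 0) → ℂ),
      ArchSmooth L 3 H' a' → ArchSmooth L 3 (Matrix.of fun i j : Fin 3 => if i.val + j.val + 1 = 3 then (1 : L) else 0) a → IsArchInnerTransfer L H' m' m a' a →
      ∀ (γ₀ : (UnitaryGroup.cmDatum L 3 H').Rational) (γ : (UnitaryGroup.cmDatum L 3 (Matrix.of fun i j : Fin 3 => if i.val + j.val + 1 = 3 then (1 : L) else 0)).Rational) (e₁ e₂ : L),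
        Corresponds (cmConjRingHom L) H' (Matrix.of fun i j : Fin 3 => if i.val + j.val + 1 = 3 then (1 : L) else 0)
          (γ₀ : unitaryGroup (cmConjRingHom L) H') (γ : unitaryGroup (cmConjRingHom L) (Matrix.of fun i j : Fin 3 => if i.val + j.val + 1 = 3 then (1 : L) else 0)) →
        e₁ ≠ e₂ → ((((γ₀ : unitaryGroup (cmConjRingHom L) H').val : GL (Fin 3) L) : Matrix (Fin 3) (Fin 3) L) - e₁ • (1 : Matrix (Fin 3) (Fin 3) L)) * ((((γ₀ : unitaryGroup (cmConjRingHom L) H').val : GL (Fin 3) L) : Matrix (Fin 3) (Fin 3) L) - e₂ • (1 : Matrix (Fin 3) (Fin 3) L)) = 0 →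
        archStableOrbitalIntegral L 3 H' mGis (fun x => kottwitzSignArchWeight L 3 H' (ConjClasses.mk x) * a' x)
            (cmRationalToArch L 3 H' γ₀) =
          archStableOrbitalIntegral L 3 (Matrix.of fun i j : Fin 3 => if i.val + j.val + 1 = 3 then (1 : L) else 0) mqis
            (fun x => kottwitzSignArchWeight L 3 (Matrix.of fun i j : Fin 3 => if i.val + j.val + 1 = 3 then (1 : L) else 0) (ConjClasses.mk x) * a x)
            (cmRationalToArch L 3 (Matrix.of fun i j : Fin 3 => if i.val + j.val + 1 = 3 then (1 : L) else 0) γ)) ∧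
    -- (κ-MASS) [Lemma 14.5.2 (b) κ-half + Prop. 8.2.1; §14.5 p. 239; Prop. 10.1.2 (a)] at a split semisimple NON-CENTRAL `γ₀` with central-block partner
    -- `γH = (e₁•1₂, e₂)`, the (all-classes, weight `e_𝐀·κ ≡ 1`) adelic orbital sum of every smooth pair `f′ ↦ f^H` — local Δ-transfers of ED. 5's `(Δ, mH, mG)` at
    -- every finite place, `Δ′_∞`-transfer of the archimedean fact's `(Tinf, mHi, m′)`, all reading REGULAR members — is ONE POSITIVE multiple of `f^H(γH ⊗ 1)`
    (∀ (γ₀ : (UnitaryGroup.cmDatum L 3 H').Rational) (e₁ e₂ : L), e₁ ≠ e₂ →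
      ((((γ₀ : unitaryGroup (cmConjRingHom L) H').val : GL (Fin 3) L) : Matrix (Fin 3) (Fin 3) L) - e₁ • (1 : Matrix (Fin 3) (Fin 3) L)) * ((((γ₀ : unitaryGroup (cmConjRingHom L) H').val : GL (Fin 3) L) : Matrix (Fin 3) (Fin 3) L) - e₂ • (1 : Matrix (Fin 3) (Fin 3) L)) = 0 →
      (¬ ∃ ζ : L, (((γ₀ : unitaryGroup (cmConjRingHom L) H').val : GL (Fin 3) L) : Matrix (Fin 3) (Fin 3) L) = ζ • (1 : Matrix (Fin 3) (Fin 3) L)) →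
      -- `e₁` is the DOUBLE eigenvalue (ref1 R1-165 O1: the partner `γH = (e₁•1₂, e₂)` below is print's `γ_H` with `A_{G∕H}(γ_H) = 𝒪_st(γ₀)` only then)
      (((γ₀ : unitaryGroup (cmConjRingHom L) H').val : GL (Fin 3) L) : Matrix (Fin 3) (Fin 3) L).charpoly =
        (Polynomial.X - Polynomial.C e₁) ^ 2 * (Polynomial.X - Polynomial.C e₂) →
      ∀ (γH : (UnitaryGroup.cmDatum L 2 (Matrix.of fun i j : Fin 2 => if i.val + j.val + 1 = 2 then (1 : L) else 0)).Rational ×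
          (UnitaryGroup.cmDatum L 1 (Matrix.of fun i j : Fin 1 => if i.val + j.val + 1 = 1 then (1 : L) else 0)).Rational),
        (((γH.1 : unitaryGroup (cmConjRingHom L) (Matrix.of fun i j : Fin 2 => if i.val + j.val + 1 = 2 then (1 : L) else 0)).val : GL (Fin 2) L) : Matrix (Fin 2) (Fin 2) L) =
          e₁ • (1 : Matrix (Fin 2) (Fin 2) L) →
        (((γH.2 : unitaryGroup (cmConjRingHom L) (Matrix.of fun i j : Fin 1 => if i.val + j.val + 1 = 1 then (1 : L) else 0)).val : GL (Fin 1) L) : Matrix (Fin 1) (Fin 1) L) 0 0 = e₂ →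
        ∃ C : ℝ, 0 < C ∧
          ∀ (T : UnitaryGroup.PureTensor L 3 H')
            (TH : UnitaryGroup.PureTensor₂ L (Matrix.of fun i j : Fin 2 => if i.val + j.val + 1 = 2 then (1 : L) else 0) (Matrix.of fun i j : Fin 1 => if i.val + j.val + 1 = 1 then (1 : L) else 0)),
            T.IsTest → TH.IsUnramified₂ → (∀ v ∈ TH.S, IsLocSmooth (TH.loc v)) → ArchSmooth₂ L TH.arch →
            (∀ v, IsLocalDeltaTransfer L H' v (Δ v) (mH v) (mG v) (TH.loc v) (T.loc v)) →
            IsArchDeltaTransfer L H' Tinf mHi m' TH.arch T.arch →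
            adelicStableOrbitalSum (MatchingAdeleG₂.classes L H' H' γ₀)
                (UnitaryGroup.OrbitalMeasureFamily.ofLocalAdelic L 3 H' mGs mGis) T.eval =
              (C : ℂ) * TH.eval ((UnitaryGroup.cmDatum L 2 (Matrix.of fun i j : Fin 2 => if i.val + j.val + 1 = 2 then (1 : L) else 0)).toAdelic γH.1,
                (UnitaryGroup.cmDatum L 1 (Matrix.of fun i j : Fin 1 => if i.val + j.val + 1 = 1 then (1 : L) else 0)).toAdelic γH.2))

set_option maxHeartbeats 16000000 in
set_option synthInstance.maxHeartbeats 800000 in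
/-- **TIE (∀Δ ⇒ at `Δ`)**: the fact at a frame gives it at every fixed collection `Δ` (instantiation of its `Δ`-binder). [cite: Rogawski1990, §14.5 Lemma 14.5.2 (b) pp. 238–239] -/
theorem singularEllipticTransferCanonicalAtDelta_of (h : SingularEllipticTransferCanonical L H' Tinf νH νG νGi νqi νHi νA) :
    SingularEllipticTransferCanonicalAtDelta L H' Tinf Δ νH νG νGi νqi νHi νA :=
  fun hanis Sbad => h hanis Sbad Δ

variable {L H' Tinf Δ νH νG νGi νqi νHi νA} in
set_option maxHeartbeats 16000000 in
set_option synthInstance.maxHeartbeats 800000 in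
/-- **The fact at `Δ` delivers members satisfying the matrix** (definitional unfolding; ★ `SingularEllipticTransferCanonical.exists_singularTransferMembers` at a fixed `Δ`).
[cite: Rogawski1990, §14.5 Lemma 14.5.2 (b) p. 239] -/
theorem SingularEllipticTransferCanonicalAtDelta.exists_singularTransferMembers (h : SingularEllipticTransferCanonicalAtDelta L H' Tinf Δ νH νG νGi νqi νHi νA)
    (hanis : ∀ x : Fin 3 → L, hermForm (cmConjRingHom L) H' x x = 0 → x = 0)
    (Sbad : Finset (HeightOneSpectrum (𝓞 ↥(maximalRealSubfield L))))
    (mH : ∀ v : HeightOneSpectrum (𝓞 ↥(maximalRealSubfield L)),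
        OrbitalMeasureFamily ((UnitaryGroup.cmDatum L 2 (Matrix.of fun i j : Fin 2 => if i.val + j.val + 1 = 2 then (1 : L) else 0)).Local v ×
          (UnitaryGroup.cmDatum L 1 (Matrix.of fun i j : Fin 1 => if i.val + j.val + 1 = 1 then (1 : L) else 0)).Local v))
    (mG : ∀ v : HeightOneSpectrum (𝓞 ↥(maximalRealSubfield L)), OrbitalMeasureFamily ((UnitaryGroup.cmDatum L 3 H').Local v))
    (hCK : CanonicalTransferMatrix L H' Tinf.Δ νH νG Sbad Δ mH mG)
    (m' : OrbitalMeasureFamily (UnitaryGroup.arch (↥(maximalRealSubfield L)) L (IsCMField.complexConj L) 3 H'))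
    (m : OrbitalMeasureFamily (UnitaryGroup.arch (↥(maximalRealSubfield L)) L (IsCMField.complexConj L) 3
          (Matrix.of fun i j : Fin 3 => if i.val + j.val + 1 = 3 then (1 : L) else 0)))
    (mHi : OrbitalMeasureFamily (UnitaryGroup.arch (↥(maximalRealSubfield L)) L (IsCMField.complexConj L) 2
            (Matrix.of fun i j : Fin 2 => if i.val + j.val + 1 = 2 then (1 : L) else 0) ×
          UnitaryGroup.arch (↥(maximalRealSubfield L)) L (IsCMField.complexConj L) 1
            (Matrix.of fun i j : Fin 1 => if i.val + j.val + 1 = 1 then (1 : L) else 0)))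
    (t' : ∀ γ' : UnitaryGroup.arch (↥(maximalRealSubfield L)) L (IsCMField.complexConj L) 3 H',
          Measure (Subgroup.centralizer ({γ'} : Set (UnitaryGroup.arch (↥(maximalRealSubfield L)) L (IsCMField.complexConj L) 3 H'))))
    (t : ∀ γ : UnitaryGroup.arch (↥(maximalRealSubfield L)) L (IsCMField.complexConj L) 3
            (Matrix.of fun i j : Fin 3 => if i.val + j.val + 1 = 3 then (1 : L) else 0),
          Measure (Subgroup.centralizer ({γ} : Set (UnitaryGroup.arch (↥(maximalRealSubfield L)) L (IsCMField.complexConj L) 3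
            (Matrix.of fun i j : Fin 3 => if i.val + j.val + 1 = 3 then (1 : L) else 0)))))
    (tH : ∀ γH : UnitaryGroup.arch (↥(maximalRealSubfield L)) L (IsCMField.complexConj L) 2
              (Matrix.of fun i j : Fin 2 => if i.val + j.val + 1 = 2 then (1 : L) else 0) ×
            UnitaryGroup.arch (↥(maximalRealSubfield L)) L (IsCMField.complexConj L) 1
              (Matrix.of fun i j : Fin 1 => if i.val + j.val + 1 = 1 then (1 : L) else 0),
          Measure (Subgroup.centralizer ({γH} : Set (UnitaryGroup.arch (↥(maximalRealSubfield L)) L (IsCMField.complexConj L) 2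
              (Matrix.of fun i j : Fin 2 => if i.val + j.val + 1 = 2 then (1 : L) else 0) ×
            UnitaryGroup.arch (↥(maximalRealSubfield L)) L (IsCMField.complexConj L) 1
              (Matrix.of fun i j : Fin 1 => if i.val + j.val + 1 = 1 then (1 : L) else 0)))))
    (hACS : ArchCanonicalSingularMatrix L H' Tinf νGi νqi νHi hanis m' m mHi t' t tH) :
    ∃ mGs mGis mqis, SingularTransferMembers L H' Tinf νA Δ mH mG m' m mHi mGs mGis mqis :=
  h hanis Sbad mH mG hCK m' m mHi t' t tH hACS

/-! ## §2 THE FACT PINNED at print's pair `(Δ‴_∞, Δ‴)` [§4.9 p. 55; §14.6 p. 242] — the type of `Rung0WitnessS.hSET` (Defs ED. «#175 PINNED») -/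

/-- **[Rogawski1990 §14.5 L. 14.5.2 (b); §4.9 p. 55] SINGULAR-ELLIPTIC TRANSFER (CANONICAL) PINNED AT A FRAME**: `…AtDelta` at `Tinf := archCanonicalTransferFactor L H′ μω`
(`Δ‴_∞`) and `Δ := finExplicitCollection L H′ μω (finExplicitDelta_conj_left_all …) (finExplicitDelta_conj_right_all …)` (`(Δ‴_v)_v`) — print's own factors; `Δ` is NO LONGER A
BINDER.  A HYPOTHESIS wherever used. [cite: Rogawski1990, §14.5 Lemma 14.5.2 (b) pp. 238–239; §4.9 p. 55; §14.6 p. 242] -/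
def SingularEllipticTransferCanonicalPinned : Prop :=
  SingularEllipticTransferCanonicalAtDelta L H' (archCanonicalTransferFactor L H' μω)
    (finExplicitCollection L H' μω (finExplicitDelta_conj_left_all L H' μω) (finExplicitDelta_conj_right_all L H' μω)) νH νG νGi νqi νHi νA

set_option maxHeartbeats 16000000 in
set_option synthInstance.maxHeartbeats 800000 in
/-- **TIE (∀Δ at `Δ‴_∞` ⇒ PINNED)**. [cite: Rogawski1990, §14.5 Lemma 14.5.2 (b) pp. 238–239; §4.9 p. 55] -/
theorem singularEllipticTransferCanonicalPinned_of (h : SingularEllipticTransferCanonical L H' (archCanonicalTransferFactor L H' μω) νH νG νGi νqi νHi νA) :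
    SingularEllipticTransferCanonicalPinned L H' μω νH νG νGi νqi νHi νA :=
  singularEllipticTransferCanonicalAtDelta_of L H' _ _ νH νG νGi νqi νHi νA h

end FactPinned

end Literature.NumberTheory.Rogawski1990

end
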